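import Mathlib
import Summits.Ventures.PercRepro2.SevenKernel
import Summits.Ventures.PercRepro2.SevenConn
import Summits.Ventures.PercRepro2.SevenTables
import Summits.Ventures.PercRepro2.SevenTyped
import Summits.Ventures.PercRepro2.SevenCover01
import Summits.Ventures.PercRepro2.SevenCover02
import Summits.Ventures.PercRepro2.SevenCover03
import Summits.Ventures.PercRepro2.SevenCover04
import Summits.Ventures.PercRepro2.SevenCover05
import Summits.Ventures.PercRepro2.SevenCover06
import Summits.Ventures.PercRepro2.SevenCover07
import Summits.Ventures.PercRepro2.SevenCover08
import Summits.Ventures.PercRepro2.SevenCover09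
import Summits.Ventures.PercRepro2.SevenCover10
import Summits.Ventures.PercRepro2.SevenCover11
import Summits.Ventures.PercRepro2.SevenCover12
import Summits.Ventures.PercRepro2.SevenCover13
import Summits.Ventures.PercRepro2.SevenCover14
import Summits.Ventures.PercRepro2.SevenCover15
import Summits.Ventures.PercRepro2.SevenCover16
import Summits.Ventures.PercRepro2.SevenCover17
import Summits.Ventures.PercRepro2.SevenCover18
import Summits.Ventures.PercRepro2.SevenCover19
import Summits.Ventures.PercRepro2.SevenCover20
import Summits.Ventures.PercRepro2.SevenCover21
import Summits.Ventures.PercRepro2.SevenCover92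
import Summits.Ventures.PercRepro2.SevenCover23
import Summits.Ventures.PercRepro2.BlockSubstConn
import Summits.Ventures.PercRepro2.BlockSubstLaw
import Summits.Ventures.PercRepro2.HCovSwap

/-!
# THEOREM 34 — THE ≤ 8-EDGE COVER: (HCOV) ON THE 46 COVER SKELETONS AND ON EVERY GRAPH INSIDE ONE OF THEM
(blind cell PercRepro2, mine-2 g34)

**The subgraph lemma.** `HCov_of_subgraph`: if every edge of a graph `ends : E → Sym2 V` (any vertex type) is the
image under an injective `q : Fin 7 → V` of an edge of a certified skeleton `S`, then (HCOV) holds on `ends` at the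
marks `q 0, …, q 4` for every weight vector — every edge its own block of the block substitution along `q`
(`BlockSubst.HCov_of_skeleton`, mine-2 g33); in particular every graph on seven vertices isomorphic to a subgraph of
a certified skeleton, with the marks carried along.  `HCov_of_subgraph_id` (`q = id`) and `HCov_of_subgraph_swap` (`q` the
swap of the two unmarked vertices `5 ↔ 6`, which fixes the marks) are the two relabellings of the cover; the root
swap is `CovForm.HCov_swap`.

**THEOREM 34.** `cert_cov` / `HCov_cov`: row 2′TRI and (HCOV) on each of the 46 cover skeletons `cov01 … cov46`
(`SevenCover01–23.lean` and `SevenCover92.lean` — `cov43r`, `cov44r` replacing the unserved `SevenCover22.lean` — one `decide +kernel` each), for every weight vector.  By the census of this generation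
(res7.c + cover.c, two codes), EVERY seven-vertex marked graph with at most eight edges that lies in typer-1 g52's
weighted residual `WReducedB` (68 with seven edges, 1,694 with eight; marks `0 … 4`, unmarked `5, 6`) is, up to the
root swap and the unmarked swap, a subgraph of one of the 46 — so `HCov_of_subgraph_id` / `_swap` + `HCov_swap` give
(HCOV) on every such graph for every weight vector, and `HCov_of_subgraph` gives it on every block substitution of
such a graph (`n` arbitrary).  Every seven-vertex marked graph with `≤ 8` edges outside the residual is reduced by
typer-1's chain (`WRed.HCov_all_iff_HCovWRedB_all`) to smaller instances or is a five- or six-terminal instance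
(Theorems 30 / 32).  Own work; standard axioms.
-/

namespace Summit.Ventures.PercRepro2

namespace Seven

/-! ## The subgraph lemma -/

section Subgraph

variable {R : Type*} [Field R] [LinearOrder R] [IsStrictOrderedRing R]

/-- **The subgraph lemma**: a graph on any vertex type every edge of which is the `q`-image of an edge of a certified
skeleton `S` (`q : Fin 7 → V` injective) satisfies (HCOV) at the marks `q 0, q 1, q 2, q 3, q 4` for every weight
vector — every edge its own block of the block substitution of `S` along `q`. -/
theorem HCov_of_subgraph (S : Fin 12 → Fin 7 × Fin 7) (hS : Cert S) {V E : Type*} [DecidableEq V] [Fintype E]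
    [DecidableEq E] (ends : E → Sym2 V) (q : Fin 7 → V) (hq : Function.Injective q)
    (h : ∀ e, ∃ j, ends e = (Seven.ends S j).map q) (p : E → R) (hp : IsProbVec p) :
    CovForm.HCov p ends (q 0) (q 1) (q 2) (q 3) (q 4) := by
  classical
  let blk : E → Fin 12 := fun e => Classical.choose (h e)
  have hblk : ∀ e, ends e = (Seven.ends S (blk e)).map q := fun e => Classical.choose_spec (h e)
  let Vj : Fin 12 → Set V := fun j => {x | x ∈ (Seven.ends S j).map q}
  have hB : BlockSubst.IsBlockSubst ends (Seven.ends S) q blk Vj :=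
    { ends_mem := fun e x hx => by
        show x ∈ (Seven.ends S (blk e)).map q
        rw [← hblk e]; exact hx
      term_mem := fun j k hk => by
        show q k ∈ (Seven.ends S j).map q
        exact Sym2.mem_map.2 ⟨k, hk, rfl⟩
      inter_terms := fun j j' _ x hx _ => by
        obtain ⟨k, hk, rfl⟩ := Sym2.mem_map.1 hx
        exact ⟨k, hk, rfl⟩
      term_only := fun j k hk => by
        obtain ⟨a, ha, hak⟩ := Sym2.mem_map.1 hk
        rw [← hq hak]; exact ha
      q_inj := hq }
  exact BlockSubst.HCov_of_skeleton hB 0 1 2 3 4 (fun r hr => HCov_seven S hS r hr) p hp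

/-- The subgraph lemma with the identity relabelling: a subgraph of a certified skeleton. -/
theorem HCov_of_subgraph_id (S : Fin 12 → Fin 7 × Fin 7) (hS : Cert S) {E : Type*} [Fintype E] [DecidableEq E]
    (ends : E → Sym2 (Fin 7)) (h : ∀ e, ∃ j, ends e = Seven.ends S j) (p : E → R) (hp : IsProbVec p) :
    CovForm.HCov p ends 0 1 2 3 4 :=
  HCov_of_subgraph S hS ends id Function.injective_id
    (fun e => by obtain ⟨j, hj⟩ := h e; exact ⟨j, by rw [hj]; rfl⟩) p hp

/-- The swap of the two unmarked vertices `5 ↔ 6` of `Fin 7`. -/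
def uwSwap : Fin 7 → Fin 7 := Equiv.swap 5 6

/-- The subgraph lemma with the unmarked vertices swapped: a graph whose edges are the `5 ↔ 6`-images of edges of a
certified skeleton satisfies (HCOV) at the marks `0, 1, 2, 3, 4` (the swap fixes the marks). -/
theorem HCov_of_subgraph_swap (S : Fin 12 → Fin 7 × Fin 7) (hS : Cert S) {E : Type*} [Fintype E] [DecidableEq E]
    (ends : E → Sym2 (Fin 7)) (h : ∀ e, ∃ j, ends e = (Seven.ends S j).map uwSwap) (p : E → R)
    (hp : IsProbVec p) : CovForm.HCov p ends 0 1 2 3 4 := by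
  have := HCov_of_subgraph S hS ends uwSwap (Equiv.injective _) h p hp
  simpa [uwSwap, Equiv.swap_apply_of_ne_of_ne] using this

end Subgraph

/-! ## The 46 cover skeletons -/

/-- The 46 skeletons of the `≤ 8`-edge cover, as a vector. -/
def covVec : Fin 46 → (Fin 12 → Fin 7 × Fin 7) :=
  ![cov01, cov02, cov03, cov04, cov05, cov06, cov07, cov08, cov09, cov10, cov11, cov12, cov13, cov14, cov15, cov16, cov17, cov18, cov19, cov20, cov21, cov22, cov23, cov24, cov25, cov26, cov27, cov28, cov29, cov30, cov31, cov32, cov33, cov34, cov35, cov36, cov37, cov38, cov39, cov40, cov41, cov42, cov43r, cov44r, cov45, cov46]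

/-- **THEOREM 34 (kernel form): every cover skeleton has its certificate.** -/
theorem cert_cov (i : Fin 46) : Cert (covVec i) := by
  fin_cases i
  · exact cert_cov01
  · exact cert_cov02
  · exact cert_cov03
  · exact cert_cov04
  · exact cert_cov05
  · exact cert_cov06
  · exact cert_cov07
  · exact cert_cov08
  · exact cert_cov09
  · exact cert_cov10
  · exact cert_cov11
  · exact cert_cov12
  · exact cert_cov13
  · exact cert_cov14
  · exact cert_cov15
  · exact cert_cov16
  · exact cert_cov17
  · exact cert_cov18
  · exact cert_cov19
  · exact cert_cov20
  · exact cert_cov21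
  · exact cert_cov22
  · exact cert_cov23
  · exact cert_cov24
  · exact cert_cov25
  · exact cert_cov26
  · exact cert_cov27
  · exact cert_cov28
  · exact cert_cov29
  · exact cert_cov30
  · exact cert_cov31
  · exact cert_cov32
  · exact cert_cov33
  · exact cert_cov34
  · exact cert_cov35
  · exact cert_cov36
  · exact cert_cov37
  · exact cert_cov38
  · exact cert_cov39
  · exact cert_cov40
  · exact cert_cov41
  · exact cert_cov42
  · exact cert_cov43r
  · exact cert_cov44r
  · exact cert_cov45
  · exact cert_cov46

section Theorem

variable {R : Type*} [Field R] [LinearOrder R] [IsStrictOrderedRing R]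

/-- **THEOREM 34 (typed form): row 2′TRI on every cover skeleton.** -/
theorem typedBases_cov (i : Fin 46) : CovForm.TypedBases (R := R) (ends (covVec i)) 0 1 2 3 4 :=
  typedBases (covVec i) (cert_cov i)

/-- **THEOREM 34: (HCOV) on every cover skeleton for every weight vector** — and hence, by
`HCov_of_subgraph_id` / `HCov_of_subgraph_swap` / `CovForm.HCov_swap`, on every residual seven-vertex marked graph
with at most eight edges (census of record: all 68 + 1,694 of them lie inside one of the 46 up to the two swaps). -/
theorem HCov_cov (i : Fin 46) (p : Fin 12 → R) (hp : IsProbVec p) :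
    CovForm.HCov p (ends (covVec i)) 0 1 2 3 4 :=
  HCov_seven (covVec i) (cert_cov i) p hp

/-- **A graph inside a cover skeleton** (up to the unmarked swap) satisfies (HCOV) for every weight vector. -/
theorem HCov_of_cov {E : Type*} [Fintype E] [DecidableEq E] (ends : E → Sym2 (Fin 7)) (i : Fin 46)
    (h : (∀ e, ∃ j, ends e = Seven.ends (covVec i) j) ∨ (∀ e, ∃ j, ends e = (Seven.ends (covVec i) j).map uwSwap))
    (p : E → R) (hp : IsProbVec p) : CovForm.HCov p ends 0 1 2 3 4 :=
  h.elim (fun h => HCov_of_subgraph_id (covVec i) (cert_cov i) ends h p hp)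
    (fun h => HCov_of_subgraph_swap (covVec i) (cert_cov i) ends h p hp)

end Theorem

end Seven

end Summit.Ventures.PercRepro2
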